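import Summits.HodgeConjecture.HodgeConjecture.Theorems.Ring2BindersAbelianSchemeVHCNodes
import Summits.HodgeConjecture.HodgeConjecture.Theorems.AnchorTransportVariationalHodgeQuasiProjective
import Summits.HodgeConjecture.HodgeConjecture.Theses.HeckePrymWeil
import Literature.AlgebraicGeometry.Motives.AbelianSchemeProjective
import HarnessLib

/-!
# Ring 2 — binder seat b02 (Hodge ladder stage 3): the print residual of row b02 `AbelianSchemeVHC` IS a booked
# Literature named fact — `Motives.raynaud1970_abelianScheme_section_projective` (p143462)

HONEST FRAMING: research route conditional on HC_CM; not a corollary; Q11.4-sentence-2 already refuted in dim ≥ 3.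

Cell `pub-hodge-ring2`, binder seat `ring2-b02`, row b02 of `BINDER-OWNERS.md` (`Ring2.Hypotheses.AbelianSchemeVHC`,
`Theorems/Ring2Hypotheses.lean`:140; OPEN, print-equivalent to `HC_AV`, nothing to discharge). `HC_CM` is not mentioned
in any statement below; nothing here is a case of the Hodge conjecture; no `sorry`, no definition, no NEW Literature
fact. ONE EXISTING Literature named fact is displayed as a hypothesis throughout (never asserted, never discharged):
`Literature.AlgebraicGeometry.Motives.raynaud1970_abelianScheme_section_projective`
(`Literature/AlgebraicGeometry/Motives/AbelianSchemeProjective.lean`:56, accepted p143462 as the gate-relocated fact of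
route HeckePrymWeil's crux file `Theorems/HeckePrymWeilWeilVariationalHodgeCoreIff.lean`): *a smooth proper morphism
of `ℂ`-schemes with a section over a smooth affine `ℂ`-scheme, all of whose complex fibres are (underlying schemes of)
abelian varieties, is H-projective over the base* — [cite: LaurentSchroer2023, §4 Prop. 4.3] (the section is the zero
of a unique abelian-scheme structure; generalising [cite: MumfordGIT, Thm. 6.14]) with
[cite: GortzWedhorn2023, §(27.53) Thm. 27.291] (= Raynaud 1970, LNM 119, Thm. XI 1.4: an abelian scheme over a
normal noetherian base is projective) and [cite: GortzWedhorn2020, Summary 13.71 (3)]; the fact's own docstring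
records how the printed all-fibres hypothesis is met from the complex fibres. §4's two theorems display in addition
the refereed André-1996 facts `andre1996_cmAnchoredPencil` (c11) / `andre1996_cmHodgeClasses_algebraicallyAnchoredPencils`
(c12), as in the earlier parts. Nothing is discharged and no number of `BINDER-OWNERS.md` moves.

WHAT THIS PART DOES. Part (v7) `Ring2BindersAbelianSchemeVHCNodes.lean` (p238171) typed the two print residuals of
row b02 as OBLIGATION NODES — `AbelianSchemeQuasiProjective` (:157; census N96) ⟹
`OneParameterAbelianSchemeQuasiProjective` (:168; N97) — and proved row b02 ⟺ its germ form ⟺ its uncountable form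
(U) MODULO N97. LEAD L44.3 (i): "the residual N96 ⟹ N97 is a THEOREM IN PRINT typed as an obligation node exactly
like b01's `MumfordTateCMAnchors` — a missing-input candidate (KIND CITE once a Literature fact or a Theorems proof
books it)". It is ALREADY BOOKED: the tree holds the named fact above since p143462 (another route's reduction of
Grothendieck's variational statement along √-p Weil abelian families to sectioned curves). This file binds:

* §1 `abelianSchemeQuasiProjective_of_raynaud1970` — **fact ⟹ N96** (the fact gives a closed `S`-immersion
  `𝒳 ↪ ℙᴺ_ℂ × S`; over a smooth AFFINE base that makes the total space quasi-projective over `ℂ`: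
  `Theorems.isQuasiProjectiveOver_of_isClosedImmersion_of_isAffine`, Hartshorne II §4), hence ⟹ N97
  (`oneParameterAbelianSchemeQuasiProjective_of_raynaud1970`); and the EXACT READING
  `abelianSchemeQuasiProjective_iff_sectionProjective` — on row b02's carriers (smooth projective families, tree
  sense: proper, smooth, fibrewise projective) N96 ⟺ the fact's own conclusion shape (H-projectivity over the base),
  by `Theorems.exists_isClosedImmersion_of_isSmoothProjectiveFamily` (proper + quasi-projective total space ⟹ closed
  `S`-immersion into `ℙᴺ × S`). So N96 is the fact `raynaud1970_abelianScheme_section_projective` restricted to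
  b02's carriers — b01's pattern (`MumfordTateCMAnchors` kernel-bound to `deligne1982_exists_cmAnchoredHodgeFamily`).
* §2 **row b02 ⟺ `OneParameterAbelianSchemeVHCGerm` ⟺ (U) `OneParameterAbelianSchemeVHCUncountable` MODULO THE BOOKED
  FACT ONLY** (`abelianSchemeVHC_iff_germ_of_raynaud1970`, `abelianSchemeVHC_iff_uncountable_of_raynaud1970`): along
  one-parameter abelian schemes (section, smooth irreducible affine curve base, quasi-projective total space) a
  fibrewise rational `(p,p)` global class algebraic on ONE fibre is algebraic on all fibres iff on a Euclidean-open set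
  of fibres iff on UNCOUNTABLY many — granted Raynaud's theorem as printed.
* §3 part XXVII's printed-carrier nodes reach row b02 modulo the fact: `VariationalHodgeQP → AbelianSchemeVHC`,
  `FlatSectionsAlgebraicQP → AbelianSchemeVHC` (`…_of_raynaud1970`).
* §4 `HC_AV ⟺ (U)` and `HC_AV ⟺ germ form` modulo {c11, c12, the fact} — no `HC_CM`, no obligation node.
* §5 CROSS-ROUTE, fact-free: row b02 ⟹ route HeckePrymWeil's crux `Theses.HeckePrymWeil.WeilVariationalHodge`
  (stmt-HodgeConjecture-14497: the variational statement along √-p Weil abelian families; forget the endomorphism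
  `φ'`) — `weilVariationalHodge_of_abelianSchemeVHC`; hence (U) ⟹ that crux modulo the fact.

What is NOT claimed: the fact (a HYPOTHESIS `hR` everywhere; KIND CITE, not discharged — no `_holds`); any node; any
case of `AbelianSchemeVHC`, of `WeilVariationalHodge` or of HC; anything about `HC_CM`. Row b02 stays OPEN ≡ `HC_AV`
modulo print; «10 · 0» untouched.

References: [LaurentSchroer2023] B. Laurent, S. Schröer, *Para-abelian varieties and Albanese maps*, Bull. Braz.
Math. Soc. 55 (2024), §4 Def. 4.2, Prop. 4.3 (held: arXiv 2101.10829, p. 12); [GortzWedhorn2023] U. Görtz,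
T. Wedhorn, *Algebraic Geometry II*, Thm. 27.291 (held, p. 951); [Raynaud1970] M. Raynaud, *Faisceaux amples sur les
schémas en groupes et les espaces homogènes*, LNM 119, Ch. XI Thm. 1.4 (not held, acq-09263; cited after Görtz–Wedhorn);
[GortzWedhorn2020] *Algebraic Geometry I*, Summary 13.71 (3); [MumfordGIT] Thm. 6.14, Prop. 6.15; [Hartshorne1977]
II §4 p. 103, Ex. 4.9; [CharlesSchnell2014Notes] Conj. 11.3.1, Prop. 11.3.11 (proof); [Andre1996Motifs] §6.3;
[Grothendieck1966] fn. 13; [Weil1977HodgeRing].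
-/

-- every declaration of this problem lives in `Summit.HodgeConjecture.HodgeConjecture.…` (summit = sub-problem);
-- namespace `…Ring2.Binders` = the binder seats of the cell's Hodge-ladder stage 3 (`BINDER-OWNERS.md`)
set_option linter.dupNamespace false

noncomputable section

open CategoryTheory AlgebraicGeometry Topology MonoidalCategory
open Literature.AlgebraicGeometry Literature.AlgebraicGeometry.Motives
open Literature.AlgebraicGeometry.HodgeTheory
open Literature.AlgebraicGeometry.Andre1996 (andre1996_cmAnchoredPencil
  andre1996_cmHodgeClasses_algebraicallyAnchoredPencils)

namespace Summit.HodgeConjecture.HodgeConjecture.Ring2.Binders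

open Summit.HodgeConjecture.HodgeConjecture.Ring2.Hypotheses

/-! ## §1 The residual nodes are the booked fact `raynaud1970_abelianScheme_section_projective` -/

/-- **Fact ⟹ N96 `AbelianSchemeQuasiProjective`.** For `f : 𝒳 ⟶ S` a smooth projective family (tree sense: smooth
of relative dimension `n`, proper, fibrewise projective) with a section over a smooth irreducible affine `S`, all
complex fibres abelian varieties: the named fact gives a closed `S`-immersion `ι : 𝒳 ↪ ℙᴺ_ℂ × S` with `ι ≫ pr_S = f`
(Laurent–Schröer Prop. 4.3: the section is the zero of an abelian-scheme structure; Görtz–Wedhorn II Thm. 27.291 =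
Raynaud XI 1.4: abelian schemes over normal noetherian bases are projective), and over a smooth AFFINE base an
H-projective family has quasi-projective total space (`Theorems.isQuasiProjectiveOver_of_isClosedImmersion_of_isAffine`,
Hartshorne II §4). Irreducibility and the relative dimension are idle. CONDITIONAL on the named fact (displayed).
[cite: LaurentSchroer2023, §4 Prop. 4.3] [cite: GortzWedhorn2023, §(27.53) Thm. 27.291]
[cite: Hartshorne1977, Ch. II §4 p. 103 and Ex. 4.9] -/
theorem abelianSchemeQuasiProjective_of_raynaud1970 (hR : raynaud1970_abelianScheme_section_projective) :
    AbelianSchemeQuasiProjective := by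
  intro n 𝒳 S f hf _ haff hsm habel he
  obtain ⟨e, he⟩ := he
  haveI := haff
  haveI := hsm
  exact Theorems.isQuasiProjectiveOver_of_isClosedImmersion_of_isAffine
    (hR f e he hf.smooth hf.isProper haff hsm fun t => by
      obtain ⟨A', -, h⟩ := habel t
      exact ⟨A', h⟩)

/-- **Fact ⟹ N97 `OneParameterAbelianSchemeQuasiProjective`** (the curve residual is implied by the affine one,
`oneParameterAbelianSchemeQuasiProjective_of_abelianSchemeQuasiProjective`). CONDITIONAL on the named fact.
[cite: GortzWedhorn2023, §(27.53) Thm. 27.291] [cite: LaurentSchroer2023, §4 Prop. 4.3] -/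
theorem oneParameterAbelianSchemeQuasiProjective_of_raynaud1970
    (hR : raynaud1970_abelianScheme_section_projective) : OneParameterAbelianSchemeQuasiProjective :=
  oneParameterAbelianSchemeQuasiProjective_of_abelianSchemeQuasiProjective
    (abelianSchemeQuasiProjective_of_raynaud1970 hR)

/-- **EXACT READING of N96 on row b02's carriers: quasi-projective total space ⟺ H-projective over the base.** For
the families of N96 (proper, with irreducible smooth affine base) the conclusion `IsQuasiProjectiveOver 𝒳` is
EQUIVALENT to the conclusion shape of the named fact, a closed `S`-immersion `𝒳 ↪ ℙᴺ_ℂ × S` over `f`: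
`→` by `Theorems.exists_isClosedImmersion_of_isSmoothProjectiveFamily` (a proper family with quasi-projective total
space embeds closed in some `ℙᴺ × S`: closed graph), `←` by `Theorems.isQuasiProjectiveOver_of_isClosedImmersion_of_isAffine`.
So N96 is `raynaud1970_abelianScheme_section_projective` read on b02's carriers (the fact is typed slightly more
generally: no irreducibility, no relative dimension). Unconditional. [cite: Hartshorne1977, Ch. II §4 p. 103 and Ex. 4.9]
[cite: GortzWedhorn2020, Summary 13.71 (3)] -/
theorem abelianSchemeQuasiProjective_iff_sectionProjective :
    AbelianSchemeQuasiProjective ↔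
      ∀ ⦃n : ℕ⦄ ⦃𝒳 S : SchemeOver ℂ⦄ (f : 𝒳 ⟶ S), IsSmoothProjectiveFamily f n → IrreducibleSpace S.left →
        IsAffine S.left → AlgebraicGeometry.Smooth S.hom →
        (∀ s : ComplexPoints S, ∃ A' : AbelianVariety ℂ, A'.dim = n ∧ Nonempty (A'.X ≅ fiberOver f s)) →
        (∃ e : S ⟶ 𝒳, e ≫ f = 𝟙 S) →
        ∃ (N : ℕ) (ι : 𝒳 ⟶ projectiveSpace N ℂ ⊗ S), IsClosedImmersion ι.left ∧
          ι ≫ CartesianMonoidalCategory.snd (projectiveSpace N ℂ) S = f := by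
  constructor
  · intro h n 𝒳 S f hf hirr haff hsm habel he
    exact Theorems.exists_isClosedImmersion_of_isSmoothProjectiveFamily hf (h f hf hirr haff hsm habel he)
  · intro h n 𝒳 S f hf hirr haff hsm habel he
    haveI := haff
    haveI := hsm
    exact Theorems.isQuasiProjectiveOver_of_isClosedImmersion_of_isAffine (h f hf hirr haff hsm habel he)

/-! ## §2 Row b02 ⟺ its germ form ⟺ its uncountable form (U), modulo the booked fact only -/

/-- **EXACTNESS modulo Raynaud's theorem: row b02 `AbelianSchemeVHC` ⟺ its germ form on one-parameter abelian
schemes** — part (v7)'s `abelianSchemeVHC_iff_germ_of_oneParameterAbelianSchemeQuasiProjective` with the residual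
supplied by the fact. CONDITIONAL on the named fact (used in `←` only).
[cite: CharlesSchnell2014Notes, Conj. 11.3.1 and Prop. 11.3.11 (proof)] [cite: GortzWedhorn2023, §(27.53) Thm. 27.291] -/
theorem abelianSchemeVHC_iff_germ_of_raynaud1970 (hR : raynaud1970_abelianScheme_section_projective) :
    AbelianSchemeVHC ↔ OneParameterAbelianSchemeVHCGerm :=
  abelianSchemeVHC_iff_germ_of_oneParameterAbelianSchemeQuasiProjective
    (oneParameterAbelianSchemeQuasiProjective_of_raynaud1970 hR)

/-- **EXACTNESS modulo Raynaud's theorem: row b02 `AbelianSchemeVHC` ⟺ (U)** — on one-parameter abelian schemes with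
quasi-projective total space a fibrewise-Hodge global class algebraic on one fibre is algebraic on UNCOUNTABLY many
fibres; part (v7)'s `abelianSchemeVHC_iff_uncountable_of_oneParameterAbelianSchemeQuasiProjective` with the residual
supplied by the fact (closing: Charles–Schnell's countable union of algebraicity loci, PROVED in the tree, and
thickness of uncountable sets on curves). CONDITIONAL on the named fact (used in `←` only).
[cite: CharlesSchnell2014Notes, Conj. 11.3.1 and Prop. 11.3.11 (proof)] [cite: GortzWedhorn2023, §(27.53) Thm. 27.291] -/
theorem abelianSchemeVHC_iff_uncountable_of_raynaud1970 (hR : raynaud1970_abelianScheme_section_projective) :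
    AbelianSchemeVHC ↔ OneParameterAbelianSchemeVHCUncountable :=
  abelianSchemeVHC_iff_uncountable_of_oneParameterAbelianSchemeQuasiProjective
    (oneParameterAbelianSchemeQuasiProjective_of_raynaud1970 hR)

/-- **(U) ⟹ row b02, granted Raynaud's theorem** (the `←` arrow in isolation). [cite: CharlesSchnell2014Notes, Prop. 11.3.11 (proof)]
[cite: GortzWedhorn2023, §(27.53) Thm. 27.291] -/
theorem abelianSchemeVHC_of_uncountable_of_raynaud1970 (hR : raynaud1970_abelianScheme_section_projective)
    (hU : OneParameterAbelianSchemeVHCUncountable) : AbelianSchemeVHC :=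
  (abelianSchemeVHC_iff_uncountable_of_raynaud1970 hR).mpr hU

/-- **Germ form ⟹ row b02, granted Raynaud's theorem** (the `←` arrow in isolation).
[cite: CharlesSchnell2014Notes, Prop. 11.3.11 (proof)] [cite: GortzWedhorn2023, §(27.53) Thm. 27.291] -/
theorem abelianSchemeVHC_of_germ_of_raynaud1970 (hR : raynaud1970_abelianScheme_section_projective)
    (hG : OneParameterAbelianSchemeVHCGerm) : AbelianSchemeVHC :=
  (abelianSchemeVHC_iff_germ_of_raynaud1970 hR).mpr hG

/-- The two with-section nodes of part (v7) agree with (U) as well, modulo the fact: `AbelianSchemeVHCSection ⟺ (U)`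
(through row b02, `abelianSchemeVHC_iff_abelianSchemeVHCSection`). [cite: CharlesSchnell2014Notes, Conj. 11.3.1]
[cite: GortzWedhorn2023, §(27.53) Thm. 27.291] -/
theorem abelianSchemeVHCSection_iff_uncountable_of_raynaud1970
    (hR : raynaud1970_abelianScheme_section_projective) :
    AbelianSchemeVHCSection ↔ OneParameterAbelianSchemeVHCUncountable :=
  abelianSchemeVHC_iff_abelianSchemeVHCSection.symm.trans (abelianSchemeVHC_iff_uncountable_of_raynaud1970 hR)

/-- `OneParameterAbelianSchemeVHC ⟺ (U)` modulo the fact (through row b02,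
`abelianSchemeVHC_iff_oneParameterAbelianSchemeVHC`). [cite: CharlesSchnell2014Notes, Conj. 11.3.1]
[cite: GortzWedhorn2023, §(27.53) Thm. 27.291] -/
theorem oneParameterAbelianSchemeVHC_iff_uncountable_of_raynaud1970
    (hR : raynaud1970_abelianScheme_section_projective) :
    OneParameterAbelianSchemeVHC ↔ OneParameterAbelianSchemeVHCUncountable :=
  abelianSchemeVHC_iff_oneParameterAbelianSchemeVHC.symm.trans (abelianSchemeVHC_iff_uncountable_of_raynaud1970 hR)

/-! ## §3 Part XXVII's printed-carrier nodes reach row b02, modulo the booked fact -/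

/-- **`VariationalHodgeQP ⟹ AbelianSchemeVHC`, granted Raynaud's theorem** — part (v7)'s
`abelianSchemeVHC_of_variationalHodgeQP_of_oneParameterAbelianSchemeQuasiProjective` with the residual supplied by the
fact: Grothendieck's variational statement on the printed quasi-projective carriers (part XXVII) implies row b02.
CONDITIONAL on the named fact. [cite: CharlesSchnell2014Notes, Conj. 11.3.1] [cite: GortzWedhorn2023, §(27.53) Thm. 27.291] -/
theorem abelianSchemeVHC_of_variationalHodgeQP_of_raynaud1970 (hR : raynaud1970_abelianScheme_section_projective)
    (hV : VariationalHodgeQP) : AbelianSchemeVHC :=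
  abelianSchemeVHC_of_variationalHodgeQP_of_oneParameterAbelianSchemeQuasiProjective
    (oneParameterAbelianSchemeQuasiProjective_of_raynaud1970 hR) hV

/-- (flat-section form) **Charles–Schnell's Conj. 11.3.1 on its printed carriers (`FlatSectionsAlgebraicQP`) implies
row b02, granted Raynaud's theorem.** CONDITIONAL on the named fact.
[cite: CharlesSchnell2014Notes, Conj. 11.3.1 and Thm. 11.3.4] [cite: GortzWedhorn2023, §(27.53) Thm. 27.291] -/
theorem abelianSchemeVHC_of_flatSectionsAlgebraicQP_of_raynaud1970
    (hR : raynaud1970_abelianScheme_section_projective) (hF : FlatSectionsAlgebraicQP) : AbelianSchemeVHC :=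
  abelianSchemeVHC_of_flatSectionsAlgebraicQP_of_oneParameterAbelianSchemeQuasiProjective
    (oneParameterAbelianSchemeQuasiProjective_of_raynaud1970 hR) hF

/-! ## §4 The target `HC_AV`, modulo André 1996 and Raynaud 1970 only (no obligation node, no `HC_CM`) -/

/-- **`HC_AV` ⟺ (U), modulo André 1996 Lemme 6.3.1 (c11), Lemmes 6.3.2–6.3.3 (c12) and Raynaud's theorem**: the
Hodge conjecture for abelian varieties holds iff along every one-parameter abelian scheme with quasi-projective total
space a fibrewise-Hodge global class algebraic on one fibre is algebraic on uncountably many fibres — part (v7)'s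
`hc_av_iff_oneParameterAbelianSchemeVHCUncountable_of_andre1996` with the residual supplied by the fact. Three
refereed theorems in print as displayed binders; no `HC_CM`. [cite: Andre1996Motifs, §6.3 Lemmes 6.3.1–6.3.3 and Remarque 2 (p. 33)]
[cite: CharlesSchnell2014Notes, Cor. 11.3.6 and Prop. 11.3.11 (proof)] [cite: GortzWedhorn2023, §(27.53) Thm. 27.291] -/
theorem hc_av_iff_oneParameterAbelianSchemeVHCUncountable_of_andre1996_of_raynaud1970
    (h₂₁ : andre1996_cmAnchoredPencil) (h₂₂ : andre1996_cmHodgeClasses_algebraicallyAnchoredPencils)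
    (hR : raynaud1970_abelianScheme_section_projective) :
    Theses.PadicSemiregularLift.HodgeAbelianVarieties ↔ OneParameterAbelianSchemeVHCUncountable :=
  hc_av_iff_oneParameterAbelianSchemeVHCUncountable_of_andre1996 h₂₁ h₂₂
    (oneParameterAbelianSchemeQuasiProjective_of_raynaud1970 hR)

/-- **`HC_AV` ⟺ the germ form on one-parameter abelian schemes, modulo c11, c12 and Raynaud's theorem** (deform
IV's (E₂′) `Deform.HC_AV_iff_abelianSchemeVHC_of_andre1996` composed with §2). No `HC_CM`.
[cite: Andre1996Motifs, §6.3 Lemmes 6.3.1–6.3.3 and Remarque 2 (p. 33)] [cite: CharlesSchnell2014Notes, Cor. 11.3.6]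
[cite: GortzWedhorn2023, §(27.53) Thm. 27.291] -/
theorem hc_av_iff_oneParameterAbelianSchemeVHCGerm_of_andre1996_of_raynaud1970
    (h₂₁ : andre1996_cmAnchoredPencil) (h₂₂ : andre1996_cmHodgeClasses_algebraicallyAnchoredPencils)
    (hR : raynaud1970_abelianScheme_section_projective) :
    Theses.PadicSemiregularLift.HodgeAbelianVarieties ↔ OneParameterAbelianSchemeVHCGerm :=
  (Deform.HC_AV_iff_abelianSchemeVHC_of_andre1996 h₂₁ h₂₂).trans (abelianSchemeVHC_iff_germ_of_raynaud1970 hR)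

/-! ## §5 Cross-route: row b02 implies route HeckePrymWeil's crux `WeilVariationalHodge` (fact-free) -/

/-- **Row b02 ⟹ `Theses.HeckePrymWeil.WeilVariationalHodge`** (stmt-HodgeConjecture-14497, the variational Hodge
statement along smooth projective families of √-p Weil abelian `2M`-folds, `p ≡ 3 (4)` prime, `p ≥ 7`, `M ≥ 1`):
such a family is a family all of whose complex fibres are abelian varieties of dimension `2M` (forget the
endomorphism `φ'` with `φ' ∘ φ' = -p`), so row b02 applies to it with `n = 2M`, codimension `M`. Fact-free,
unconditional implication between two OPEN statements; neither is claimed. [cite: Grothendieck1966, footnote 13]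
[cite: Weil1977HodgeRing] -/
theorem weilVariationalHodge_of_abelianSchemeVHC (h : AbelianSchemeVHC) : Theses.HeckePrymWeil.WeilVariationalHodge := by
  intro p _ _ _ M _ 𝒳 S f hf hirr hsm W hW hA h₀ s
  exact h f hf hirr hsm (fun t => by
    obtain ⟨A', -, hd, -, hi⟩ := hA t
    exact ⟨A', hd, hi⟩) M W hW h₀ s

/-- **(U) ⟹ `WeilVariationalHodge`, granted Raynaud's theorem**: uncountable spreading of one algebraic fibre along
one-parameter abelian schemes (row b02's sharp one-parameter form) already gives route HeckePrymWeil's crux — compare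
that route's own certificate `Theorems.weilVariationalHodge_iff_anchorSpreadsUncountably_of_raynaud` (its CORE is (U)
restricted to √-p Weil families with `M ≥ 2`). CONDITIONAL on the named fact.
[cite: CharlesSchnell2014Notes, Prop. 11.3.11 (proof)] [cite: GortzWedhorn2023, §(27.53) Thm. 27.291] -/
theorem weilVariationalHodge_of_uncountable_of_raynaud1970 (hR : raynaud1970_abelianScheme_section_projective)
    (hU : OneParameterAbelianSchemeVHCUncountable) : Theses.HeckePrymWeil.WeilVariationalHodge :=
  weilVariationalHodge_of_abelianSchemeVHC (abelianSchemeVHC_of_uncountable_of_raynaud1970 hR hU)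

/-- ON-PATH bookkeeping for the cross-route edge: the summit gives `WeilVariationalHodge` through row b02.
[folklore] -/
theorem weilVariationalHodge_of_hodgeConjecture_via_abelianSchemeVHC (h : _root_.HodgeConjecture) :
    Theses.HeckePrymWeil.WeilVariationalHodge :=
  weilVariationalHodge_of_abelianSchemeVHC (abelianSchemeVHC_of_hodgeConjecture h)

/-- `HC_AV` gives `WeilVariationalHodge` through row b02 (`abelianSchemeVHC_of_hc_av`). [cite: CharlesSchnell2014Notes, Cor. 11.3.6] -/
theorem weilVariationalHodge_of_hc_av (h : Theses.PadicSemiregularLift.HodgeAbelianVarieties) :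
    Theses.HeckePrymWeil.WeilVariationalHodge :=
  weilVariationalHodge_of_abelianSchemeVHC (abelianSchemeVHC_of_hc_av h)

/-! ## Audit

`#print axioms` of every theorem above: `propext`, `Classical.choice`, `Quot.sound` (checked at submission). No
`sorry`, no new `def`/`axiom`/`opaque`, no new node. Literature named facts displayed as hypotheses: the EXISTING
`Motives.raynaud1970_abelianScheme_section_projective` (p143462; `hR`, in §§1–4 and in
`weilVariationalHodge_of_uncountable_of_raynaud1970`) and, in §4 only, André 1996 c11/c12 (`h₂₁`, `h₂₂`) — all
consumed, never asserted, never discharged; `abelianSchemeQuasiProjective_iff_sectionProjective` and the §5 arrows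
`weilVariationalHodge_of_abelianSchemeVHC` / `…_of_hodgeConjecture_via_abelianSchemeVHC` / `…_of_hc_av` are fact-free.
-/

end Summit.HodgeConjecture.HodgeConjecture.Ring2.Binders

end
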